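import Summits.CriticalPhenomena.PercolationContinuityZ3.Theorems.PercNearOneGluingNoHeavyLowerTailIncStarPsiSameBranch
import Summits.CriticalPhenomena.PercolationContinuityZ3.Theorems.PercNearOneGluingNoHeavyLowerTailIncStarPsiDiffBranch
import Summits.CriticalPhenomena.PercolationContinuityZ3.Theorems.PercNearOneGluingNoHeavyLowerTailIncStarBranchLemma
import HarnessLib

/-!
# THEOREM (I2′)-tree: `Ψ ≥ 0` on every apex-forest

Support file for the Sahi programme (`--supports stmt-CriticalPhenomena-4575`, prover prim-sahi-p2 gen 19).  No definitions, no named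
facts, no sorries; standard axioms.  Memo `FROM-prim-nh-lead-4575-g120-STAR-HALF.md` §8 (lead g120, THEOREM (I2′)-tree) and
`prim-sahi-p2/PROOF-E3.md` (28s)–(28u), (29f).

**Theorem `psi_nonneg`.**  For product Bernoulli percolation on the pairs of `Fin n` with root `s`, every port `v ≠ s` and all targets `b, c`:
if the environment `fromEdgeSet {z | s ∉ z ∧ w z ≠ 0}` is acyclic then `Ψ(w; v; b, c) ≥ 0`, where (root-connection form, `P = prodBernoulli w`)
`Ψ = A(Ξ_b + Ξ_c + D_bc) − D_bD_c + D_b·Cov_c + D_c·Cov_b`, `A = P(v↛s)`, `D_t = P(t↔v ∧ v↛s)`, `D_bc = P(b↔v ∧ c↔v ∧ v↛s)`,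
`Ξ_b = P(b↔v ∧ v↛s ∧ s↔c)`, `H_t = P(v↛s ∧ t↮v ∧ s↔t)`, `Cov_t = D_t + H_t − A·P(t↔v ∨ s↔t)`.  At a port WITHOUT root pair this is the
lead's and p2 gen 18's one-sided tree inequality (I2′) ((28s): `Slack_R ≥ 0`; exact agreement checked in gen 19, PROOF-E3 (29f)) — the
two-target input of CONJECTURE FC's root pairs (B′-forest ⟸ switching lemma + (L2)-tree + (I2′)-tree, (28t)–(28u)) and the sibling of the
R-side lemma of THEOREM C½.  It is false off forests (the RT refuter, (28t)).

**Proof** (the lead's alternating induction, in bridge form; PROOF-E3 (29f)).  Induction on the number of positive environment pairs, over all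
ports.  `b = v`: `Ψ = A(D_c + 2H_c − A·Z_c) ≥ 0` by the branch lemma (`IncStar.branchLemma`); `c = v` by symmetry (`psi_symm`); `b` not in
the tree of `v`: `Ψ = A·Ξ_c` (independence through the root); `c` likewise; otherwise let `x_b, x_c` be the neighbours of `v` towards `b, c`:
if `x_b = x_c` the same-branch step `IncStar.psi_bridge_step_sameBranch` and the induction hypothesis at the port `x_b` of `w[s(x_b,v)↦0]`;
if `x_b ≠ x_c` the two-branch step `IncStar.psi_bridge_step_diffBranch` with the branch lemma at `(x_b, b)` and at `(v, c)` under `w[s(x_b,v)↦0]`.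
-/

noncomputable section

namespace Summit.CriticalPhenomena.PercolationContinuityZ3.Theorems

namespace IncStar

open MeasureTheory Set Literature.Probability.Percolation Literature.Probability.LatticeModels EdgeInduction
open scoped Classical

variable {n : ℕ}

/-- `Ψ` is symmetric in the two targets. [this work] -/
theorem psi_symm (w : Sym2 (Fin n) → unitInterval) (s v b c : Fin n) :
    (prodBernoulli w).real (openConn s v)ᶜ * ((prodBernoulli w).real ((openConn b v \ openConn s v) ∩ openConn s c)
            + (prodBernoulli w).real ((openConn c v \ openConn s v) ∩ openConn s b) + (prodBernoulli w).real ((openConn b v ∩ openConn c v) \ openConn s v))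
        - (prodBernoulli w).real (openConn b v \ openConn s v) * (prodBernoulli w).real (openConn c v \ openConn s v)
        + (prodBernoulli w).real (openConn b v \ openConn s v) * ((prodBernoulli w).real (openConn c v \ openConn s v) + (prodBernoulli w).real ((openConn s v)ᶜ ∩ (openConn c v)ᶜ ∩ openConn s c)
            - (prodBernoulli w).real (openConn s v)ᶜ * (prodBernoulli w).real (openConn c v ∪ openConn s c))
        + (prodBernoulli w).real (openConn c v \ openConn s v) * ((prodBernoulli w).real (openConn b v \ openConn s v) + (prodBernoulli w).real ((openConn s v)ᶜ ∩ (openConn b v)ᶜ ∩ openConn s b)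
            - (prodBernoulli w).real (openConn s v)ᶜ * (prodBernoulli w).real (openConn b v ∪ openConn s b))
    = (prodBernoulli w).real (openConn s v)ᶜ * ((prodBernoulli w).real ((openConn c v \ openConn s v) ∩ openConn s b)
            + (prodBernoulli w).real ((openConn b v \ openConn s v) ∩ openConn s c) + (prodBernoulli w).real ((openConn c v ∩ openConn b v) \ openConn s v))
        - (prodBernoulli w).real (openConn c v \ openConn s v) * (prodBernoulli w).real (openConn b v \ openConn s v)
        + (prodBernoulli w).real (openConn c v \ openConn s v) * ((prodBernoulli w).real (openConn b v \ openConn s v) + (prodBernoulli w).real ((openConn s v)ᶜ ∩ (openConn b v)ᶜ ∩ openConn s b)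
            - (prodBernoulli w).real (openConn s v)ᶜ * (prodBernoulli w).real (openConn b v ∪ openConn s b))
        + (prodBernoulli w).real (openConn b v \ openConn s v) * ((prodBernoulli w).real (openConn c v \ openConn s v) + (prodBernoulli w).real ((openConn s v)ᶜ ∩ (openConn c v)ᶜ ∩ openConn s c)
            - (prodBernoulli w).real (openConn s v)ᶜ * (prodBernoulli w).real (openConn c v ∪ openConn s c)) := by
  rw [Set.inter_comm (openConn b v) (openConn c v)]
  ring

/-- **`Ψ` at the port** (`b = v`): `Ψ = A·(D_c + 2H_c − A·Z_c) ≥ 0` by the branch lemma. [this work] -/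
theorem psi_port (w : Sym2 (Fin n) → unitInterval) {s v : Fin n} (c : Fin n) (hv : v ≠ s)
    (hforest : (SimpleGraph.fromEdgeSet {z : Sym2 (Fin n) | s ∉ z ∧ w z ≠ 0}).IsAcyclic) :
    0 ≤ (prodBernoulli w).real (openConn s v)ᶜ * ((prodBernoulli w).real ((openConn v v \ openConn s v) ∩ openConn s c)
            + (prodBernoulli w).real ((openConn c v \ openConn s v) ∩ openConn s v) + (prodBernoulli w).real ((openConn v v ∩ openConn c v) \ openConn s v))
        - (prodBernoulli w).real (openConn v v \ openConn s v) * (prodBernoulli w).real (openConn c v \ openConn s v)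
        + (prodBernoulli w).real (openConn v v \ openConn s v) * ((prodBernoulli w).real (openConn c v \ openConn s v) + (prodBernoulli w).real ((openConn s v)ᶜ ∩ (openConn c v)ᶜ ∩ openConn s c)
            - (prodBernoulli w).real (openConn s v)ᶜ * (prodBernoulli w).real (openConn c v ∪ openConn s c))
        + (prodBernoulli w).real (openConn c v \ openConn s v) * ((prodBernoulli w).real (openConn v v \ openConn s v) + (prodBernoulli w).real ((openConn s v)ᶜ ∩ (openConn v v)ᶜ ∩ openConn s v)
            - (prodBernoulli w).real (openConn s v)ᶜ * (prodBernoulli w).real (openConn v v ∪ openConn s v)) := by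
  have Br := branchLemma w c hv hforest
  have hvv : (openConn v v : Set (BondConfig (Fin n))) = Set.univ := Set.eq_univ_of_forall fun _ => SimpleGraph.Reachable.refl v
  have e1 : (Set.univ \ openConn s v : Set (BondConfig (Fin n))) = (openConn s v)ᶜ := (Set.compl_eq_univ_sdiff _).symm
  have e2 : ((openConn s v)ᶜ ∩ openConn s c : Set (BondConfig (Fin n))) = (openConn s v)ᶜ ∩ (openConn c v)ᶜ ∩ openConn s c := by
    ext ω
    simp only [Set.mem_inter_iff, Set.mem_compl_iff]
    constructor
    · rintro ⟨hsv, hsc⟩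
      exact ⟨⟨hsv, fun hcv => hsv (SimpleGraph.Reachable.trans hsc hcv)⟩, hsc⟩
    · rintro ⟨⟨hsv, -⟩, hsc⟩
      exact ⟨hsv, hsc⟩
  have e3 : ((openConn c v \ openConn s v) ∩ openConn s v : Set (BondConfig (Fin n))) = ∅ := by
    ext ω; simp only [Set.mem_inter_iff, Set.mem_sdiff, Set.mem_empty_iff_false, iff_false]; tauto
  have e4 : ((openConn s v)ᶜ ∩ (Set.univ : Set (BondConfig (Fin n)))ᶜ ∩ openConn s v) = ∅ := by
    rw [Set.compl_univ, Set.inter_empty, Set.empty_inter]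
  rw [hvv, e1, Set.univ_inter, e2, e3, e4, Set.univ_union, measureReal_empty, probReal_univ]
  have hA : 0 ≤ (prodBernoulli w).real (openConn s v)ᶜ := measureReal_nonneg
  nlinarith [mul_nonneg hA (sub_nonneg.2 Br)]

/-- **`Ψ` for coincident targets** (`b = c`): `Ψ = D_b·[(D_b + 2H_b − A·Z_b) + A(1 − Z_b)] ≥ 0`. [this work] -/
theorem psi_coincident (w : Sym2 (Fin n) → unitInterval) {s v : Fin n} (b : Fin n) (hv : v ≠ s)
    (hforest : (SimpleGraph.fromEdgeSet {z : Sym2 (Fin n) | s ∉ z ∧ w z ≠ 0}).IsAcyclic) :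
    0 ≤ (prodBernoulli w).real (openConn s v)ᶜ * ((prodBernoulli w).real ((openConn b v \ openConn s v) ∩ openConn s b)
            + (prodBernoulli w).real ((openConn b v \ openConn s v) ∩ openConn s b) + (prodBernoulli w).real ((openConn b v ∩ openConn b v) \ openConn s v))
        - (prodBernoulli w).real (openConn b v \ openConn s v) * (prodBernoulli w).real (openConn b v \ openConn s v)
        + (prodBernoulli w).real (openConn b v \ openConn s v) * ((prodBernoulli w).real (openConn b v \ openConn s v) + (prodBernoulli w).real ((openConn s v)ᶜ ∩ (openConn b v)ᶜ ∩ openConn s b)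
            - (prodBernoulli w).real (openConn s v)ᶜ * (prodBernoulli w).real (openConn b v ∪ openConn s b))
        + (prodBernoulli w).real (openConn b v \ openConn s v) * ((prodBernoulli w).real (openConn b v \ openConn s v) + (prodBernoulli w).real ((openConn s v)ᶜ ∩ (openConn b v)ᶜ ∩ openConn s b)
            - (prodBernoulli w).real (openConn s v)ᶜ * (prodBernoulli w).real (openConn b v ∪ openConn s b)) := by
  have Br := branchLemma w b hv hforest
  have e1 : ((openConn b v \ openConn s v) ∩ openConn s b : Set (BondConfig (Fin n))) = ∅ := by
    ext ω
    simp only [Set.mem_inter_iff, Set.mem_sdiff, Set.mem_empty_iff_false, iff_false, not_and]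
    intro h hsb
    exact h.2 (SimpleGraph.Reachable.trans hsb h.1)
  rw [e1, Set.inter_self, measureReal_empty]
  have hD : 0 ≤ (prodBernoulli w).real (openConn b v \ openConn s v) := measureReal_nonneg
  have hA : 0 ≤ (prodBernoulli w).real (openConn s v)ᶜ := measureReal_nonneg
  have hZ : (prodBernoulli w).real (openConn b v ∪ openConn s b) ≤ 1 := measureReal_le_one
  nlinarith [mul_nonneg hD (sub_nonneg.2 Br), mul_nonneg hD (mul_nonneg hA (sub_nonneg.2 hZ))]

/-- **`Ψ` when `b` lies outside the tree of the port**: `Ψ = A·Ξ_c ≥ 0` (independence through the root). [this work] -/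
theorem psi_of_not_reachable (w : Sym2 (Fin n) → unitInterval) {s v b : Fin n} (c : Fin n) (hv : v ≠ s)
    (hb : ¬ (SimpleGraph.fromEdgeSet {z : Sym2 (Fin n) | s ∉ z ∧ w z ≠ 0}).Reachable v b) :
    0 ≤ (prodBernoulli w).real (openConn s v)ᶜ * ((prodBernoulli w).real ((openConn b v \ openConn s v) ∩ openConn s c)
            + (prodBernoulli w).real ((openConn c v \ openConn s v) ∩ openConn s b) + (prodBernoulli w).real ((openConn b v ∩ openConn c v) \ openConn s v))
        - (prodBernoulli w).real (openConn b v \ openConn s v) * (prodBernoulli w).real (openConn c v \ openConn s v)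
        + (prodBernoulli w).real (openConn b v \ openConn s v) * ((prodBernoulli w).real (openConn c v \ openConn s v) + (prodBernoulli w).real ((openConn s v)ᶜ ∩ (openConn c v)ᶜ ∩ openConn s c)
            - (prodBernoulli w).real (openConn s v)ᶜ * (prodBernoulli w).real (openConn c v ∪ openConn s c))
        + (prodBernoulli w).real (openConn c v \ openConn s v) * ((prodBernoulli w).real (openConn b v \ openConn s v) + (prodBernoulli w).real ((openConn s v)ᶜ ∩ (openConn b v)ᶜ ∩ openConn s b)
            - (prodBernoulli w).real (openConn s v)ᶜ * (prodBernoulli w).real (openConn b v ∪ openConn s b)) := by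
  set H := SimpleGraph.fromEdgeSet {z : Sym2 (Fin n) | s ∉ z ∧ w z ≠ 0} with hH
  set L : Set (Fin n) := {x | (H.deleteEdges ∅).Reachable v x}
  have hsL : s ∉ L := apexForest_root_not_mem w hv _
  have hvL : v ∈ L := SimpleGraph.Reachable.refl v
  have hbL : b ∉ L := fun h => hb (h.mono (SimpleGraph.deleteEdges_le _))
  have hs1 : s ∈ insert s L := Set.mem_insert s L
  have hv1 : v ∈ insert s L := Set.mem_insert_of_mem s hvL
  have hcross : ∀ x y : Fin n, x ∈ L → y ∉ L → y ≠ s → w s(x, y) = 0 :=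
    fun x y hx hy hys => apexForest_cross w hv ∅ hx hy hys (Set.notMem_empty _)
  set G : Set (BondConfig (Fin n)) := {ω | ∀ e', w e' = 0 → e' ∉ ω}
  have hG1 : (prodBernoulli w).real G = 1 := real_sureClosed w
  have hωG : ∀ ω ∈ G, ∀ x y : Fin n, x ∈ L → y ∉ L → y ≠ s → s(x, y) ∉ ω :=
    fun ω hω x y hx hy hys => hω _ (hcross x y hx hy hys)
  set Vn : Set (BondConfig (Fin n)) := openConnIn (insert s L) s v
  set Bf : Set (BondConfig (Fin n)) := openConnIn Lᶜ s b
  have c_sv : ∀ ω ∈ G, (ω ∈ openConn s v ↔ ω ∈ Vn) := fun ω hω => bridge_conn_ll L hsL (hωG ω hω) hs1 hv1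
  have c_sb : ∀ ω ∈ G, (ω ∈ openConn s b ↔ ω ∈ Bf) := fun ω hω => by
    rw [bridge_conn_lr L hsL (hωG ω hω) hs1 hbL]
    exact ⟨fun h => h.2, fun h => ⟨⟨hs1, hs1, SimpleGraph.Reachable.refl _⟩, h⟩⟩
  have c_bv : ∀ ω ∈ G, (ω ∈ openConn b v ↔ ω ∈ Bf ∧ ω ∈ Vn) := fun ω hω => by
    rw [bridge_conn_rl L hsL (hωG ω hω) hbL hv1]
    exact ⟨fun h => ⟨openConnIn_symm' h.1, h.2⟩, fun h => ⟨openConnIn_symm' h.1, h.2⟩⟩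
  have hdiff : ∀ {A B : Set (BondConfig (Fin n))} {K' : Set (Sym2 (Fin n))},
      DeterminedBy A K' → DeterminedBy B K' → DeterminedBy (A \ B) K' := by
    intro A B K' hA hB
    rw [determinedBy_iff] at hA hB ⊢
    intro ω ω' h
    rw [Set.mem_sdiff, Set.mem_sdiff, hA ω ω' h, hB ω ω' h]
  have zero_of_empty : ∀ {A : Set (BondConfig (Fin n))}, (∀ ω ∈ G, ω ∉ A) → (prodBernoulli w).real A = 0 := by
    intro A hA
    have h : (prodBernoulli w).real A = (prodBernoulli w).real (∅ : Set (BondConfig (Fin n))) :=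
      real_congr_of_sure hG1 fun ω hω => ⟨fun h => (hA ω hω h).elim, fun h => (Set.notMem_empty _ h).elim⟩
    rw [h, measureReal_empty]
  have eA : (prodBernoulli w).real (openConn s v)ᶜ = (prodBernoulli w).real (Set.univ \ Vn) :=
    real_congr_of_sure hG1 fun ω hω => by
      rw [Set.mem_compl_iff, c_sv ω hω, Set.mem_sdiff]; exact ⟨fun h => ⟨Set.mem_univ _, h⟩, fun h => h.2⟩
  have eDb : (prodBernoulli w).real (openConn b v \ openConn s v) = 0 :=
    zero_of_empty fun ω hω h => by rw [Set.mem_sdiff, c_bv ω hω, c_sv ω hω] at h; exact h.2 h.1.2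
  have eDbc : (prodBernoulli w).real ((openConn b v ∩ openConn c v) \ openConn s v) = 0 :=
    zero_of_empty fun ω hω h => by rw [Set.mem_sdiff, Set.mem_inter_iff, c_bv ω hω, c_sv ω hω] at h; exact h.2 h.1.1.2
  have eXb : (prodBernoulli w).real ((openConn b v \ openConn s v) ∩ openConn s c) = 0 :=
    zero_of_empty fun ω hω h => by rw [Set.mem_inter_iff, Set.mem_sdiff, c_bv ω hω, c_sv ω hω] at h; exact h.1.2 h.1.1.2
  have eHb : (prodBernoulli w).real ((openConn s v)ᶜ ∩ (openConn b v)ᶜ ∩ openConn s b)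
      = (prodBernoulli w).real (Set.univ \ Vn) * (prodBernoulli w).real Bf := by
    rw [← indep_blocks w L s (hdiff (determinedBy_univ _) (IncStarCutVertex.determinedBy_openConnIn_offDiag _ s v))
      (IncStarCutVertex.determinedBy_openConnIn_offDiag _ s b)]
    refine real_congr_of_sure hG1 fun ω hω => ?_
    simp only [Set.mem_inter_iff, Set.mem_compl_iff, Set.mem_sdiff, Set.mem_univ, true_and, c_sv ω hω, c_bv ω hω, c_sb ω hω]
    tauto
  have eZb : (prodBernoulli w).real (openConn b v ∪ openConn s b) = (prodBernoulli w).real Bf :=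
    real_congr_of_sure hG1 fun ω hω => by
      rw [Set.mem_union, c_bv ω hω, c_sb ω hω]; exact ⟨fun h => h.elim (fun h' => h'.1) id, fun h => Or.inr h⟩
  rw [eA, eDb, eDbc, eXb, eHb, eZb]
  have hA : 0 ≤ (prodBernoulli w).real (Set.univ \ Vn) := measureReal_nonneg
  have hX : 0 ≤ (prodBernoulli w).real ((openConn c v \ openConn s v) ∩ openConn s b) := measureReal_nonneg
  nlinarith [mul_nonneg hA hX]

/-- **THEOREM (I2′)-tree: `Ψ ≥ 0` on every apex-forest**, for every port `v ≠ s` and all targets (PROOF-E3 (28s)–(28u), (29f); lead g120 §8).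
[this work] -/
theorem psi_nonneg (w : Sym2 (Fin n) → unitInterval) {s v : Fin n} (b c : Fin n) (hv : v ≠ s)
    (hforest : (SimpleGraph.fromEdgeSet {z : Sym2 (Fin n) | s ∉ z ∧ w z ≠ 0}).IsAcyclic) :
    0 ≤ (prodBernoulli w).real (openConn s v)ᶜ * ((prodBernoulli w).real ((openConn b v \ openConn s v) ∩ openConn s c)
            + (prodBernoulli w).real ((openConn c v \ openConn s v) ∩ openConn s b) + (prodBernoulli w).real ((openConn b v ∩ openConn c v) \ openConn s v))
        - (prodBernoulli w).real (openConn b v \ openConn s v) * (prodBernoulli w).real (openConn c v \ openConn s v)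
        + (prodBernoulli w).real (openConn b v \ openConn s v) * ((prodBernoulli w).real (openConn c v \ openConn s v) + (prodBernoulli w).real ((openConn s v)ᶜ ∩ (openConn c v)ᶜ ∩ openConn s c)
            - (prodBernoulli w).real (openConn s v)ᶜ * (prodBernoulli w).real (openConn c v ∪ openConn s c))
        + (prodBernoulli w).real (openConn c v \ openConn s v) * ((prodBernoulli w).real (openConn b v \ openConn s v) + (prodBernoulli w).real ((openConn s v)ᶜ ∩ (openConn b v)ᶜ ∩ openConn s b)
            - (prodBernoulli w).real (openConn s v)ᶜ * (prodBernoulli w).real (openConn b v ∪ openConn s b)) := by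
  suffices hN : ∀ (N : ℕ) (w : Sym2 (Fin n) → unitInterval) (v b c : Fin n), v ≠ s →
      (SimpleGraph.fromEdgeSet {z : Sym2 (Fin n) | s ∉ z ∧ w z ≠ 0}).IsAcyclic →
      (Finset.univ.filter fun z : Sym2 (Fin n) => ¬ z.IsDiag ∧ s ∉ z ∧ w z ≠ 0).card ≤ N →
      0 ≤ (prodBernoulli w).real (openConn s v)ᶜ * ((prodBernoulli w).real ((openConn b v \ openConn s v) ∩ openConn s c)
            + (prodBernoulli w).real ((openConn c v \ openConn s v) ∩ openConn s b) + (prodBernoulli w).real ((openConn b v ∩ openConn c v) \ openConn s v))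
        - (prodBernoulli w).real (openConn b v \ openConn s v) * (prodBernoulli w).real (openConn c v \ openConn s v)
        + (prodBernoulli w).real (openConn b v \ openConn s v) * ((prodBernoulli w).real (openConn c v \ openConn s v) + (prodBernoulli w).real ((openConn s v)ᶜ ∩ (openConn c v)ᶜ ∩ openConn s c)
            - (prodBernoulli w).real (openConn s v)ᶜ * (prodBernoulli w).real (openConn c v ∪ openConn s c))
        + (prodBernoulli w).real (openConn c v \ openConn s v) * ((prodBernoulli w).real (openConn b v \ openConn s v) + (prodBernoulli w).real ((openConn s v)ᶜ ∩ (openConn b v)ᶜ ∩ openConn s b)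
            - (prodBernoulli w).real (openConn s v)ᶜ * (prodBernoulli w).real (openConn b v ∪ openConn s b)) from
    hN _ w v b c hv hforest le_rfl
  intro N
  induction N with
  | zero =>
    intro w v b c hv hforest hN
    exact psi_step w hv hforest fun w' _ hlt _ _ => by omega
  | succ N ih =>
    intro w v b c hv hforest hN
    exact psi_step w hv hforest fun w' hf hlt v' hv' => ih w' v' b c hv' hf (by omega)
where
  /-- The inductive step (all cases). -/
  psi_step (w : Sym2 (Fin n) → unitInterval) {s v b c : Fin n} (hv : v ≠ s)
      (hforest : (SimpleGraph.fromEdgeSet {z : Sym2 (Fin n) | s ∉ z ∧ w z ≠ 0}).IsAcyclic)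
      (IH : ∀ w' : Sym2 (Fin n) → unitInterval,
        (SimpleGraph.fromEdgeSet {z : Sym2 (Fin n) | s ∉ z ∧ w' z ≠ 0}).IsAcyclic →
        (Finset.univ.filter fun z : Sym2 (Fin n) => ¬ z.IsDiag ∧ s ∉ z ∧ w' z ≠ 0).card
          < (Finset.univ.filter fun z : Sym2 (Fin n) => ¬ z.IsDiag ∧ s ∉ z ∧ w z ≠ 0).card →
        ∀ v' : Fin n, v' ≠ s → 0 ≤ (prodBernoulli w').real (openConn s v')ᶜ * ((prodBernoulli w').real ((openConn b v' \ openConn s v') ∩ openConn s c)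
                + (prodBernoulli w').real ((openConn c v' \ openConn s v') ∩ openConn s b) + (prodBernoulli w').real ((openConn b v' ∩ openConn c v') \ openConn s v'))
            - (prodBernoulli w').real (openConn b v' \ openConn s v') * (prodBernoulli w').real (openConn c v' \ openConn s v')
            + (prodBernoulli w').real (openConn b v' \ openConn s v') * ((prodBernoulli w').real (openConn c v' \ openConn s v') + (prodBernoulli w').real ((openConn s v')ᶜ ∩ (openConn c v')ᶜ ∩ openConn s c)
                - (prodBernoulli w').real (openConn s v')ᶜ * (prodBernoulli w').real (openConn c v' ∪ openConn s c))
            + (prodBernoulli w').real (openConn c v' \ openConn s v') * ((prodBernoulli w').real (openConn b v' \ openConn s v') + (prodBernoulli w').real ((openConn s v')ᶜ ∩ (openConn b v')ᶜ ∩ openConn s b)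
                - (prodBernoulli w').real (openConn s v')ᶜ * (prodBernoulli w').real (openConn b v' ∪ openConn s b))) :
      0 ≤ (prodBernoulli w).real (openConn s v)ᶜ * ((prodBernoulli w).real ((openConn b v \ openConn s v) ∩ openConn s c)
            + (prodBernoulli w).real ((openConn c v \ openConn s v) ∩ openConn s b) + (prodBernoulli w).real ((openConn b v ∩ openConn c v) \ openConn s v))
        - (prodBernoulli w).real (openConn b v \ openConn s v) * (prodBernoulli w).real (openConn c v \ openConn s v)
        + (prodBernoulli w).real (openConn b v \ openConn s v) * ((prodBernoulli w).real (openConn c v \ openConn s v) + (prodBernoulli w).real ((openConn s v)ᶜ ∩ (openConn c v)ᶜ ∩ openConn s c)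
            - (prodBernoulli w).real (openConn s v)ᶜ * (prodBernoulli w).real (openConn c v ∪ openConn s c))
        + (prodBernoulli w).real (openConn c v \ openConn s v) * ((prodBernoulli w).real (openConn b v \ openConn s v) + (prodBernoulli w).real ((openConn s v)ᶜ ∩ (openConn b v)ᶜ ∩ openConn s b)
            - (prodBernoulli w).real (openConn s v)ᶜ * (prodBernoulli w).real (openConn b v ∪ openConn s b)) := by
    by_cases hbv : b = v
    · subst hbv; exact psi_port w c hv hforest
    by_cases hcv : c = v
    · subst hcv; rw [psi_symm]; exact psi_port w b hv hforest
    set H := SimpleGraph.fromEdgeSet {z : Sym2 (Fin n) | s ∉ z ∧ w z ≠ 0} with hH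
    by_cases hrb : H.Reachable v b
    swap
    · exact psi_of_not_reachable w c hv hrb
    by_cases hrc : H.Reachable v c
    swap
    · rw [psi_symm]; exact psi_of_not_reachable w b hv hrc
    -- neighbours of `v` towards `b` and towards `c`
    have key : ∀ (t : Fin n), t ≠ v → ∀ q : H.Walk v t, q.IsPath →
        ∃ x : Fin n, H.Adj v x ∧ ∃ r : H.Walk x t, v ∉ r.support := by
      intro t ht q hq
      cases q with
      | nil => exact absurd rfl ht
      | cons hadj r =>
        rename_i x
        exact ⟨x, hadj, r, ((SimpleGraph.Walk.cons_isPath_iff hadj r).1 hq).2⟩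
    obtain ⟨pb⟩ := hrb
    obtain ⟨pc⟩ := hrc
    obtain ⟨xb, hadjb, rb, hrb'⟩ := key b hbv pb.bypass pb.bypass_isPath
    obtain ⟨xc, hadjc, rc, hrc'⟩ := key c hcv pc.bypass pc.bypass_isPath
    have hxbs : xb ≠ s := by
      intro h; rw [hH, SimpleGraph.fromEdgeSet_adj] at hadjb; exact hadjb.1.1 (h ▸ Sym2.mem_mk_right v xb)
    have hadjb' : H.Adj xb v := hadjb.symm
    have hbridge : ¬ (H.deleteEdges {s(xb, v)}).Reachable xb v :=
      SimpleGraph.isBridge_iff.1 (SimpleGraph.isAcyclic_iff_forall_adj_isBridge.1 hforest hadjb')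
    -- walks avoiding `v` avoid the edge `s(xb, v)`
    have avoid : ∀ {x t : Fin n} (r : H.Walk x t), v ∉ r.support → (H.deleteEdges {s(xb, v)}).Reachable x t := by
      intro x t r hr
      exact SimpleGraph.reachable_deleteEdges_iff_exists_walk.2 ⟨r, fun he => hr (r.snd_mem_support_of_mem_edges he)⟩
    set L : Set (Fin n) := {x | (H.deleteEdges {s(xb, v)}).Reachable xb x}
    have hsL : s ∉ L := apexForest_root_not_mem w hxbs _
    have hxL : xb ∈ L := SimpleGraph.Reachable.refl xb
    have hvL : v ∉ L := hbridge
    have hbL : b ∈ L := avoid rb hrb'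
    have hcross : ∀ x y : Fin n, x ∈ L → y ∉ L → y ≠ s → s(x, y) ≠ s(xb, v) → w s(x, y) = 0 :=
      fun x y hx hy hys hne => apexForest_cross w hxbs {s(xb, v)} hx hy hys (by rwa [Set.mem_singleton_iff])
    have hw0 : w s(xb, v) ≠ 0 := by
      rw [hH, SimpleGraph.fromEdgeSet_adj] at hadjb'; exact hadjb'.1.2
    have hz : s(xb, v) ∈ Finset.univ.filter (fun z : Sym2 (Fin n) => ¬ z.IsDiag ∧ s ∉ z ∧ w z ≠ 0) := by
      rw [hH, SimpleGraph.fromEdgeSet_adj] at hadjb'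
      simp only [Finset.mem_filter, Finset.mem_univ, true_and, Sym2.mk_isDiag_iff]
      exact ⟨hadjb'.2, hadjb'.1.1, hadjb'.1.2⟩
    have hforest0 : (SimpleGraph.fromEdgeSet {z : Sym2 (Fin n) | s ∉ z ∧ Function.update w s(xb, v) 0 z ≠ 0}).IsAcyclic :=
      hforest.anti (envGraph_update_le w s _ 0 (Or.inr rfl))
    by_cases hx : xb = xc
    · -- same branch
      subst hx
      have hcL : c ∈ L := avoid rc hrc'
      exact psi_bridge_step_sameBranch w L hsL hxL hvL hbL hcL hcross
        (IH _ hforest0 (posEnv_card_update_lt w s hz) xb hxbs)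
    · -- different branches: `c ∉ L`
      have hcL : c ∉ L := by
        intro hc
        have h1 : (H.deleteEdges {s(xb, v)}).Reachable v c := by
          refine SimpleGraph.Reachable.trans (SimpleGraph.Adj.reachable ?_) (avoid rc hrc')
          rw [SimpleGraph.deleteEdges_adj, Set.mem_singleton_iff, Sym2.eq_iff]
          refine ⟨hadjc, ?_⟩
          rintro (⟨h1, -⟩ | ⟨-, h2⟩)
          · exact hadjb.ne h1
          · exact hx h2.symm
        exact hbridge (hc.trans h1.symm)
      exact psi_bridge_step_diffBranch w L hsL hxL hvL hbL hcL hcross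
        (branchLemma (Function.update w s(xb, v) 0) b hxbs hforest0)
        (branchLemma (Function.update w s(xb, v) 0) c hv hforest0)

end IncStar

end Summit.CriticalPhenomena.PercolationContinuityZ3.Theorems
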